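import Summits.CriticalPhenomena.PercolationContinuityZ3.Theorems.Transplant.AutCocompactFinitelyGeneratedDichotomy
import HarnessLib

/-!
# A NILPOTENT group acting FAITHFULLY with finitely many orbits on a connected locally finite graph has FINITE STABILISERS — no finite-generation, no
# torsion hypothesis — hence its faithful image is FINITELY GENERATED (the last residue of the C2 action chain removed)

builds on p205010 (kernel theorem, internal audit signed; external expert review pending) — NOT used in this file.  Lane `prim-bschramm`, seat
`prim-bschramm-stmt` gen 38 (stmt port pen).  Helper file (`--supports stmt-CriticalPhenomena-4575 --as helper`); PROOFS ONLY (def-free, no `instance`,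
no notation); NOT by-name — no `@[conjecture]` node touched, STATEMENTS §5 unchanged; nothing about growth, nothing about `BenjaminiSchramm1996_conj4_endState`.

WHY.  «AutCocompactFinitelyGenerated» p595968 reached finite stabilisers of the faithful image through Schreier + Baer (torsion of a FINITELY GENERATED
nilpotent group is a finite subgroup), so its engine and the dichotomy «AutCocompactFinitelyGeneratedDichotomy» p596130 carry `[Group.FG A]` (the refuter's
desk note, P5-SHARPNESS row 120: 'expected idle').  It IS idle, by an elementary induction that needs neither finite generation nor torsion control:

THE THEOREM (`finite_upperCentralSeries_inter_stabilizer`, `stabilizer_finite_of_nilpotent_faithful`).  Let `A` act FAITHFULLY (`(∀ v, a • v = v) → a = 1`)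
by automorphisms on a connected locally finite graph with finitely many orbits (`reps`), and let `S ⊆ A` be the finite section set of
«AutCocompactAnyStabilizers» (`exists_finset_closure_smul_reps`: `closure S • reps = W`).  CLAIM: `Z_n ∩ Stab(r)` is finite for every `n` and every vertex
`r`.  `Z_0 = ⊥`.  Step: the map `s ↦ ((s • r_j)_{r_j ∈ reps}, (s g s⁻¹)_{g ∈ S})` is INJECTIVE on `Stab(r)` — if `s, s'` agree then `t = s'⁻¹ s` fixes every
representative and centralises `S`, hence `closure S`, so `t` fixes `h • r_j` for all `h ∈ closure S`, i.e. every vertex, and `t = 1` by faithfulness —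
and on `Z_{n+1} ∩ Stab(r)` it takes FINITELY many values: `s • r_j` lies in the finite set `{a • r_j : a • r = r}` («AutCocompactAnyStabilizers»
`finite_stabilizer_smul`: the isometry `s` fixing `r` keeps `r_j` in the ball `B(r, d(r, r_j))`), and `s g s⁻¹ = g · u` with `u = g⁻¹ s g s⁻¹ = ⁅g⁻¹, s⁆ ∈ Z_n`
(upper central series) and `u • r = g⁻¹ • (s • (g • r))` in the finite set `g⁻¹ • {a • (g • r) : a • r = r}`; for each such value `v` the fibre
`{u ∈ Z_n : u • r = v}` is a translate of `Z_n ∩ Stab(r)`, finite by induction.  At `Z_c = ⊤`: every stabiliser is finite.  COROLLARIES: the faithful image of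
a virtually nilpotent group acting with finitely many orbits has finite stabilisers (`finite_stabilizer_range_of_virtuallyNilpotent` — supersedes p595968's
`finite_stabilizer_range` without `[Group.FG A]`) and is FINITELY GENERATED (`fg_range_of_virtuallyNilpotent`, by p4 gen 22's quasi-transitive generating set
`VirtNilpotentAutQT.closure_genSetQT`); the FG-free Conjecture-1 dichotomy and the FG-free `p_u < 1` row are the customer file «AutCocompactDichotomy» (lead RULING #7809: corollaries as a
customer file, one name per file).  A torsion-free `A` then has TRIVIAL stabilisers (a finite subgroup of a torsion-free group is trivial) —
«AutCocompactTorsionFreeNilpotent» p595024's freeness theorem re-derived as a remark, not restated.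
[cite: BenjaminiSchramm1996, §2 Conj. 1, Conj. 4 (almost transitive graphs)] [cite: Woess2000, Prop. 3.9, Lemma 3.13 (cocompact actions)]
[cite: Trofimov1985, Thm. 2 (background: automorphism groups of graphs with polynomial growth — not used)] [cite: LyonsPeres2016, §7.4 Cor. 7.19; §7.9]
-/

noncomputable section

namespace Summit.CriticalPhenomena.PercolationContinuityZ3.Theorems.Transplant

namespace AutCyl

open SimpleGraph Literature.Barriers.CriticalPhenomena Literature.Probability.LatticeModels Literature.Probability.Percolation
open scoped Classical commutatorElement

variable {W : Type} {X : SimpleGraph W} {A : Type} [Group A] [MulAction A W] [X.LocallyFinite]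

/-! ## §1 The induction on the upper central series -/

/-- **`Z_n ∩ Stab(r)` is finite for every `n` and every vertex `r`** — `A` acting FAITHFULLY by automorphisms with finitely many orbits on a connected locally
finite graph; NO finite-generation or torsion hypothesis, `A` not even assumed nilpotent (the statement is about its upper central series).  Induction on `n`
with the injection `s ↦ ((s • r_j)_j, (s g s⁻¹)_{g ∈ S})` into a finite set (module doc). [folklore] [cite: Woess2000, Prop. 3.9, Lemma 3.13] -/
theorem finite_upperCentralSeries_inter_stabilizer (hfaith : ∀ a : A, (∀ v : W, a • v = v) → a = 1) (hact : IsActionByAut X A)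
    (hc : X.Connected) (reps : Finset W) (hcover : ∀ w : W, ∃ a : A, ∃ r ∈ reps, a • r = w) :
    ∀ (n : ℕ) (r : W), ((Subgroup.upperCentralSeries A n : Set A) ∩ (MulAction.stabilizer A r : Set A)).Finite := by
  obtain ⟨S, hS⟩ := exists_finset_closure_smul_reps hact hc reps hcover
  intro n
  induction n with
  | zero =>
    intro r
    rw [Subgroup.upperCentralSeries_zero]
    exact (Set.finite_singleton (1 : A)).subset fun a ha => by
      have h := ha.1
      rw [SetLike.mem_coe, Subgroup.mem_bot] at h
      exact h
  | succ n ih =>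
    intro r
    -- the comparison map
    let Φ : A → (↥reps → W) × (↥S → A) := fun s => (fun j => s • (j : W), fun g => s * (g : A) * s⁻¹)
    -- (a) Φ is injective on the stabiliser of `r`
    have hinj : Set.InjOn Φ ((Subgroup.upperCentralSeries A (n + 1) : Set A) ∩ (MulAction.stabilizer A r : Set A)) := by
      rintro s ⟨-, hs⟩ s' ⟨-, hs'⟩ hss'
      rw [SetLike.mem_coe, MulAction.mem_stabilizer_iff] at hs hs'
      have h1 : ∀ j : ↥reps, s • (j : W) = s' • (j : W) := fun j => congrFun (congrArg Prod.fst hss') j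
      have h2 : ∀ g : ↥S, s * (g : A) * s⁻¹ = s' * (g : A) * s'⁻¹ := fun g => congrFun (congrArg Prod.snd hss') g
      -- `t := s'⁻¹ * s` centralises `closure S` and fixes every representative, hence every vertex
      set t : A := s'⁻¹ * s with ht
      have hcen : Subgroup.closure (S : Set A) ≤ Subgroup.centralizer {t} := by
        rw [Subgroup.closure_le]
        intro g hg
        rw [SetLike.mem_coe, Subgroup.mem_centralizer_iff]
        intro x hx
        rw [Set.mem_singleton_iff] at hx
        subst hx
        have h := h2 ⟨g, hg⟩
        simp only at h
        -- from `s g s⁻¹ = s' g s'⁻¹` get `(s'⁻¹ s) g = g (s'⁻¹ s)`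
        have h' : s'⁻¹ * s * g * s⁻¹ = g * s'⁻¹ := by
          rw [mul_assoc s'⁻¹ s g, mul_assoc s'⁻¹ (s * g) s⁻¹, h, ← mul_assoc, ← mul_assoc, inv_mul_cancel, one_mul]
        calc s'⁻¹ * s * g = s'⁻¹ * s * g * s⁻¹ * s := by rw [inv_mul_cancel_right]
          _ = g * s'⁻¹ * s := by rw [h']
          _ = g * (s'⁻¹ * s) := by rw [mul_assoc]
      have hfix : ∀ v : W, t • v = v := fun v => by
        obtain ⟨a, ha, j, hj, rfl⟩ := hS v
        have hcomm : t * a = a * t := Subgroup.mem_centralizer_iff.1 (hcen ha) t (Set.mem_singleton t)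
        have htj : t • j = j := by
          rw [ht, mul_smul, h1 ⟨j, hj⟩, inv_smul_smul]
        rw [← mul_smul, hcomm, mul_smul, htj]
      have : t = 1 := hfaith t hfix
      rw [ht, inv_mul_eq_one] at this
      exact this.symm
    -- (b) Φ takes finitely many values on `Z_{n+1} ∩ Stab(r)`
    have hfin : (Φ '' ((Subgroup.upperCentralSeries A (n + 1) : Set A) ∩ (MulAction.stabilizer A r : Set A))).Finite := by
      -- first component: `s • r_j` in the finite set of `finite_stabilizer_smul`
      have hF1 : (Set.univ.pi fun j : ↥reps => {u : W | ∃ a : A, a • r = r ∧ a • (j : W) = u}).Finite :=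
        Set.Finite.pi fun j => finite_stabilizer_smul hact hc r j
      -- second component: `s g s⁻¹ ∈ T_g`, a finite set
      have hF2 : ∀ g : A, {x : A | g⁻¹ * x ∈ Subgroup.upperCentralSeries A n ∧
          (g⁻¹ * x) • r ∈ (fun u => g⁻¹ • u) '' {u : W | ∃ a : A, a • r = r ∧ a • (g • r) = u}}.Finite := fun g => by
        have hV : ((fun u => g⁻¹ • u) '' {u : W | ∃ a : A, a • r = r ∧ a • (g • r) = u}).Finite :=
          (finite_stabilizer_smul hact hc r (g • r)).image _
        refine (hV.biUnion (t := fun v => {x : A | g⁻¹ * x ∈ Subgroup.upperCentralSeries A n ∧ (g⁻¹ * x) • r = v}) fun v _ => ?_).subset ?_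
        · -- each fibre is empty or a translate of `Z_n ∩ Stab(r)`
          by_cases hne : ({x : A | g⁻¹ * x ∈ Subgroup.upperCentralSeries A n ∧ (g⁻¹ * x) • r = v}).Nonempty
          · obtain ⟨x₀, hx₀Z, hx₀v⟩ := hne
            refine (((ih r).image fun w => x₀ * w)).subset ?_
            rintro x ⟨hxZ, hxv⟩
            refine ⟨(g⁻¹ * x₀)⁻¹ * (g⁻¹ * x), ⟨?_, ?_⟩, ?_⟩
            · exact Subgroup.mul_mem _ (Subgroup.inv_mem _ hx₀Z) hxZ
            · rw [SetLike.mem_coe, MulAction.mem_stabilizer_iff, mul_smul, inv_smul_eq_iff, hxv, hx₀v]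
            · show x₀ * ((g⁻¹ * x₀)⁻¹ * (g⁻¹ * x)) = x
              group
          · rw [Set.not_nonempty_iff_eq_empty.1 hne]
            exact Set.finite_empty
        · rintro x ⟨hxZ, hxv⟩
          exact Set.mem_biUnion hxv ⟨hxZ, rfl⟩
      have hF2' : (Set.univ.pi fun g : ↥S => {x : A | (g : A)⁻¹ * x ∈ Subgroup.upperCentralSeries A n ∧
          ((g : A)⁻¹ * x) • r ∈ (fun u => (g : A)⁻¹ • u) '' {u : W | ∃ a : A, a • r = r ∧ a • ((g : A) • r) = u}}).Finite :=
        Set.Finite.pi fun g => hF2 g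
      refine (hF1.prod hF2').subset ?_
      rintro p ⟨s, ⟨hsZ, hsr⟩, rfl⟩
      rw [SetLike.mem_coe, MulAction.mem_stabilizer_iff] at hsr
      refine Set.mk_mem_prod (fun j _ => ⟨s, hsr, rfl⟩) (fun g _ => ?_)
      have hu : (g : A)⁻¹ * (s * (g : A) * s⁻¹) = ⁅(g : A)⁻¹, s⁆ := by
        simp only [commutatorElement_def, inv_inv, mul_assoc]
      refine ⟨?_, ?_⟩
      · rw [hu, ← commutatorElement_inv]
        exact Subgroup.inv_mem _ ((Subgroup.mem_upperCentralSeries_succ_iff.1 hsZ) (g : A)⁻¹)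
      · refine ⟨s • ((g : A) • r), ⟨s, hsr, rfl⟩, ?_⟩
        show (g : A)⁻¹ • s • (g : A) • r = ((g : A)⁻¹ * (s * (g : A) * s⁻¹)) • r
        rw [mul_smul, mul_smul, mul_smul, inv_smul_eq_iff.2 hsr.symm]
    exact Set.Finite.of_finite_image hfin hinj

/-- **A NILPOTENT group acting FAITHFULLY by automorphisms with finitely many orbits on a connected locally finite graph has FINITE vertex stabilisers** —
no finite-generation and no torsion hypothesis. [folklore] [cite: Woess2000, Prop. 3.9, Lemma 3.13] [cite: Trofimov1985, Thm. 2 (background only)] -/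
theorem stabilizer_finite_of_nilpotent_faithful [Group.IsNilpotent A] (hfaith : ∀ a : A, (∀ v : W, a • v = v) → a = 1)
    (hact : IsActionByAut X A) (hc : X.Connected) (reps : Finset W) (hcover : ∀ w : W, ∃ a : A, ∃ r ∈ reps, a • r = w) (w : W) :
    (MulAction.stabilizer A w : Set A).Finite := by
  obtain ⟨n, hn⟩ := Group.IsNilpotent.nilpotent A
  have h := finite_upperCentralSeries_inter_stabilizer hfaith hact hc reps hcover n w
  rw [hn, Subgroup.coe_top, Set.univ_inter] at h
  exact h

/-! ## §2 The faithful image of a virtually nilpotent group: finite stabilisers, finite generation -/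

/-- **Finite stabilisers of the faithful image — NO finite-generation hypothesis** (supersedes «AutCocompactFinitelyGenerated»'s `finite_stabilizer_range`
as a statement): `A` with a finite-index nilpotent subgroup `N`, acting by automorphisms with finitely many orbits on a connected locally finite graph ⟹
every stabiliser of the image group `(MulAction.toPermHom A W).range` is finite (restrict to the image `N₀` of `N`: faithful, nilpotent, finitely many orbits —
§1; then `[Stab : Stab ∩ N₀] ≤ [A₀ : N₀]`). [cite: BenjaminiSchramm1996, §2 (almost transitive graphs)] [cite: Woess2000, Prop. 3.9] -/
theorem finite_stabilizer_range_of_virtuallyNilpotent (N : Subgroup A) [N.FiniteIndex] [Group.IsNilpotent N] (hc : X.Connected)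
    (hact : IsActionByAut X A) (reps : Finset W) (hcover : ∀ w : W, ∃ a : A, ∃ r ∈ reps, a • r = w) (w : W) :
    (MulAction.stabilizer (MulAction.toPermHom A W).range w : Set (MulAction.toPermHom A W).range).Finite := by
  set ι : A →* Equiv.Perm W := MulAction.toPermHom A W with hι
  have he : Function.Surjective ι.rangeRestrict := ι.rangeRestrict_surjective
  set N₀ : Subgroup ι.range := N.map ι.rangeRestrict with hN₀
  haveI hN₀fi : N₀.FiniteIndex := ⟨fun h0 =>
    Subgroup.FiniteIndex.index_ne_zero (Nat.eq_zero_of_zero_dvd (h0 ▸ Subgroup.index_map_dvd (H := N) he))⟩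
  haveI : Group.IsNilpotent N₀ := Group.nilpotent_of_surjective (ι.rangeRestrict.subgroupMap N) (ι.rangeRestrict.subgroupMap_surjective N)
  have hact₀ : IsActionByAut X ι.range := isActionByAut_range hact
  obtain ⟨reps₀, hcover₀⟩ := exists_reps_of_finiteIndex N₀ reps (cover_range hcover)
  have hfaithN : ∀ m : N₀, (∀ v : W, m • v = v) → m = 1 := fun m h =>
    Subtype.ext (eq_one_of_smul_eq_range (m : ι.range) fun v => h v)
  have hN₀fin : (MulAction.stabilizer N₀ w : Set N₀).Finite :=
    stabilizer_finite_of_nilpotent_faithful hfaithN (isActionByAut_subgroup hact₀ N₀) hc reps₀ hcover₀ w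
  -- `Stab(w) ∩ N₀` is finite, and has finite index in `Stab(w)`
  set T : Subgroup ι.range := MulAction.stabilizer ι.range w with hT
  haveI : Finite (N₀.subgroupOf T) := by
    let f : N₀.subgroupOf T → MulAction.stabilizer N₀ w := fun x =>
      ⟨⟨((x : T) : ι.range), Subgroup.mem_subgroupOf.1 x.2⟩, MulAction.mem_stabilizer_iff.2 (MulAction.mem_stabilizer_iff.1 (x : T).2)⟩
    have hf : Function.Injective f := fun x y hxy =>
      Subtype.ext (Subtype.ext (congrArg (fun z : MulAction.stabilizer N₀ w => ((z : N₀) : ι.range)) hxy))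
    haveI : Finite (MulAction.stabilizer N₀ w) := hN₀fin.to_subtype
    exact Finite.of_injective f hf
  haveI : Finite T := (Subgroup.finite_iff_finite_and_finiteIndex (H := N₀.subgroupOf T)).2 ⟨inferInstance, inferInstance⟩
  exact Set.toFinite _

/-- **The faithful image of a virtually nilpotent group acting with finitely many orbits on a connected locally finite graph is FINITELY GENERATED**
(finite stabilisers, §2, then p4 gen 22's quasi-transitive generating set). [cite: Woess2000, Prop. 3.9 (cocompact actions of groups with compact stabilisers are by finitely generated groups)] -/
theorem fg_range_of_virtuallyNilpotent (N : Subgroup A) [N.FiniteIndex] [Group.IsNilpotent N] (hc : X.Connected)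
    (hact : IsActionByAut X A) (reps : Finset W) (hcover : ∀ w : W, ∃ a : A, ∃ r ∈ reps, a • r = w) :
    Group.FG (MulAction.toPermHom A W).range :=
  have hfin := fun r (_ : r ∈ reps) => finite_stabilizer_range_of_virtuallyNilpotent N hc hact reps hcover r
  ⟨⟨(VirtNilpotentAutQT.finite_genSetQT X reps hfin).toFinset,
    VirtNilpotentAutQT.closure_genSetQT (isActionByAut_range hact) hc reps (cover_range hcover) hfin⟩⟩

end AutCyl

end Summit.CriticalPhenomena.PercolationContinuityZ3.Theorems.Transplant

end
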